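import Summits.NavierStokesRegularity.NavierStokesRegularity.Theorems.TaoLadderRungThreeRestartControl
import Summits.NavierStokesRegularity.NavierStokesRegularity.Theorems.TaoLadderRungThreeRestartGlue
import Summits.NavierStokesRegularity.NavierStokesRegularity.Theorems.TaoLadderRungThreeLocalDynamicsSufficesAt
import Summits.NavierStokesRegularity.NavierStokesRegularity.Theorems.TrappingWindowRungThreeTrappingBootstrap
import Summits.NavierStokesRegularity.NavierStokesRegularity.Theorems.TrappingWindowRungThreeTailEnvelopes
import HarnessLib

/-!
# TL-M3-R64 from a PINNED inclusion certificate — `WindowCertificateAt 64 → TaoLadderRungThree.TargetR64`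

Support file for the leaf item `stmt-NavierStokesRegularity-24294`
(`Summit.NavierStokesRegularity.NavierStokesRegularity.Theses.TaoLadderRungThree.TargetR64`, rung of record TL-M3-R64).
Extracted verbatim (stub-free part) from the registered crux skeleton «monodromy-basin»
(`Cruxes.TargetR64.MonodromyBasin`, skeleton sha16 c54d6261f037dc7f, ns-idea-2 g6; critic idea-crit-3 verdict
2026-08-28T06:26:29Z PASS-WITH-PRICE, price P3: "land the by-product NOW, stub-free").

* `WindowCertificateAt R` — the sibling route's K1 body (`TrappingWindowRungThree.WindowCertificate`) with the
  spread `R` exposed instead of existentially closed (text otherwise verbatim).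
* `RobustStepDataAt R` — robust-step data at spread `R`, scale ratio `ε₀ = 1`.
* `robustStepDataAt64_of_windowCertificateAt64` — the sibling bootstrap (stmt-21749,
  `trappingWindowRungThree_trappingBootstrap_proof`) re-run with `R = 64` pinned, using the landed K2
  `trappingWindowRungThree_tailEnvelopes_proof`.
* `targetR64_of_robustStepDataAt64` — the TLR3 restart tail (items 20424/20425/20426, landed) at `R = 64`.
* `targetR64_of_windowCertificateAt64 : WindowCertificateAt 64 → TargetR64` — the corollary: ANY K1-type
  inclusion trapping certificate whose table is 64-comparable BY NAME closes the rung of record (the landed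
  K1/K2/bootstrap/transfer chain closes `R` existentially at every stage and therefore reaches only `Target`).

MODEL lattice statements only (Tao's averaged cascade); nothing here bears on Navier–Stokes itself.
-/

noncomputable section

set_option linter.dupNamespace false

namespace Summit.NavierStokesRegularity.NavierStokesRegularity.Theorems

open Set Filter Topology Literature.Analysis.FluidPDE Literature.Analysis.FluidPDE.TaoCascade
open Summit.NavierStokesRegularity.NavierStokesRegularity.Theorems
open Summit.NavierStokesRegularity.NavierStokesRegularity.Theorems.TrappingBootstrap

/-- The sibling route's inclusion trapping certificate K1 (`TrappingWindowRungThree.WindowCertificate`)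
with the spread bound `R` exposed BY NAME instead of existentially closed (verbatim otherwise). -/
def WindowCertificateAt (R : ℝ) : Prop :=
  ∃ (θ c η₀ Cb Cg : ℝ) (Kb Ka : ℤ) (i₀ : Fin 4) (α : Fin 4 → Fin 4 → Fin 4 → ℤ × ℤ × ℤ → ℝ) (X₀ : Fin 4 → ℝ) (N₀ : ℕ) (ℓ : ℕ → ℕ → (Fin 4 → ℤ → ℝ) →ₗ[ℝ] ℝ) (ctr rad : ℕ → ℕ → ℝ) (M W : ℤ → ℝ), Literature.Analysis.FluidPDE.TaoCascade.InTableClass R α ∧ X₀ i₀ ≠ 0 ∧ 0 ≤ θ ∧ θ < 1 / 2 ∧ 0 < c ∧ 0 < η₀ ∧ η₀ ≤ 1 ∧ 0 < Cb ∧ 0 < Cg ∧ 0 ≤ Kb ∧ 1 ≤ Ka ∧ (∀ l, |ℓ 0 l (Literature.Analysis.FluidPDE.TaoCascade.datumState i₀ X₀) - ctr 0 l| ≤ rad 0 l) ∧ (∀ j, j ≤ N₀ → ∀ q : Fin 4 → ℤ → ℝ, (∀ l, |ℓ j l q - ctr j l| ≤ rad j l) → ∀ i k, -Kb ≤ k →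 k ≤ Ka → |q i k| < M k) ∧ (∀ k, -Kb ≤ k → k ≤ Ka → 0 ≤ W k) ∧ c * (68 * Cb * (2 : ℝ) ^ (-(7 : ℝ) / 4 * ((Kb : ℝ) + 1)) + 47 * M (-Kb) * (2 : ℝ) ^ (-(5 : ℝ) / 2 * ((Kb : ℝ) + 1))) ≤ 1 / 8 ∧ 2560 * c * M Ka ^ 2 * (2 : ℝ) ^ (6 * (Ka : ℝ)) ≤ Real.sqrt Cg ∧ 51200 * c * Real.sqrt Cg ≤ (2 : ℝ) ^ ((Ka : ℝ) + 2) ∧ (∀ (L : ℕ) (k : ℤ), -Kb ≤ k → k ≤ Ka → 2 * Literature.Analysis.FluidPDE.TaoCascade.slackWeight 1 θ c (fun j : ℤ => if j < -Kb then 2 * (Cb * (2 : ℝ) ^ ((3 : ℝ) / 4 * (-(j : ℝ)))) ^ 2 else if Ka < j then 5 * (Cg * (2 : ℝ) ^ (-(7 : ℝ) * (j : ℝ))) else (1 / 2) * M j ^ 2 + W j) L k + (c * (2 : ℝ) ^ ((2 : ℝ) * (k : ℝ)) + 1) * M k ^ 2 ≤ W k) ∧ (∀ (j : ℕ) (η σ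 τ : ℝ) (S F : Fin 4 → ℤ → ℝ → ℝ), j ≤ N₀ → 0 ≤ η → η ≤ η₀ → 0 < σ → σ ≤ τ → (∀ i k, -Kb - 1 ≤ k → k ≤ Ka + 1 → ContDiffOn ℝ 1 (S i k) (Set.Icc 0 τ)) → (∀ l, |ℓ j l (fun i k => S i k 0) - ctr j l| ≤ rad j l) → (∀ i, ∀ s ∈ Set.Icc 0 σ, |S i (-Kb - 1) s| ≤ 6 / 5 * (Cb * (2 : ℝ) ^ ((3 : ℝ) / 4 * ((Kb : ℝ) + 1)))) → (∀ i, ∀ s ∈ Set.Icc 0 σ, |S i (Ka + 1) s| ≤ Real.sqrt (10 * Cg * (2 : ℝ) ^ (-(7 : ℝ) * ((Ka : ℝ) + 1)))) → (∀ i k, -Kb ≤ k → k ≤ Ka → ∀ s ∈ Set.Icc 0 σ, |derivWithin (S i k) (Set.Icc 0 τ) s - Literature.Analysis.FluidPDE.TaoCascade.quadTerm 1 α S i k s| ≤ η * (2 : ℝ) ^ ((2 : ℝ) * (k : ℝ)) * Real.sqrt (F i k s)) → (∀ i k, -Kb ≤ k → k ≤ Ka → ∀ s ∈ Set.Icc 0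 σ, (1 / 2) * S i k s ^ 2 ≤ F i k s ∧ F i k s ≤ (1 / 2) * S i k s ^ 2 + η * W k) → (∃ (j' : ℕ) (τ₁ a : ℝ), j' ≤ N₀ ∧ 0 < τ₁ ∧ τ₁ ≤ σ ∧ τ₁ ≤ c ∧ 0 < a ∧ (2 : ℝ) ^ (-θ) ≤ a ∧ a ≤ |S i₀ 1 τ₁| ∧ (∀ l, |ℓ j' l (fun i k => S i (1 + k) τ₁ / a) - ctr j' l| ≤ rad j' l) ∧ (∀ i, |S i (-Kb) τ₁| / a ≤ (Cb * (2 : ℝ) ^ ((3 : ℝ) / 4 * ((Kb : ℝ) + 1)))) ∧ (∀ i k, -Kb ≤ k → k ≤ Ka → ∀ s ∈ Set.Icc 0 τ₁, |S i k s| ≤ M k)) ∨ (σ < c ∧ ∀ i k, -Kb ≤ k → k ≤ Ka → ∀ s ∈ Set.Icc 0 σ, |S i k s| < M k))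

/-- Robust-step data at spread `R` and scale ratio `ε₀ = 1`: the conclusion of the sibling's
`TrappingBootstrap` / `TransferBootstrapR` with `R` exposed by name. -/
def RobustStepDataAt (R : ℝ) : Prop :=
  ∃ (θ c η : ℝ) (i₀ : Fin 4) (α : Fin 4 → Fin 4 → Fin 4 → ℤ × ℤ × ℤ → ℝ) (X₀ : Fin 4 → ℝ) (P : (Fin 4 → ℤ → ℝ) → (Fin 4 → ℤ → ℝ) → Prop) (env : ℤ → ℝ), 0 ≤ θ ∧ θ ≤ 1 / 2 ∧ 0 < c ∧ 0 < η ∧ Literature.Analysis.FluidPDE.TaoCascade.InTableClass R α ∧ X₀ i₀ ≠ 0 ∧ P (Literature.Analysis.FluidPDE.TaoCascade.datumState i₀ X₀) (Literature.Analysis.FluidPDE.TaoCascade.datumEnergy i₀ X₀) ∧ Literature.Analysis.FluidPDE.TaoCascade.RobustStep 1 θ c η i₀ α P env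

/-- **Glue 1 (proved): the trapping bootstrap with the spread carried by name.**
Port of `Theorems.trappingWindowRungThree_trappingBootstrap_proof` (stmt-21749, landed) with `R := 64`
visible; the argument is verbatim (R is a passive parameter of K1/K2). -/
theorem robustStepDataAt64_of_windowCertificateAt64 (hK1 : WindowCertificateAt 64)
    (hK2 : Summit.NavierStokesRegularity.NavierStokesRegularity.Theses.TrappingWindowRungThree.TailEnvelopes) :
    RobustStepDataAt 64 := by
  unfold WindowCertificateAt at hK1
  unfold Summit.NavierStokesRegularity.NavierStokesRegularity.Theses.TrappingWindowRungThree.TailEnvelopes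
    at hK2
  obtain ⟨θ, c, η₀, Cb, Cg, Kb, Ka, i₀, α, X₀, N₀, ℓ, ctr, rad, M, W, hα, hX₀, hθ0, hθ, hc, hη₀,
    hη₀1, hCb, hCg, hKb, hKa, hdat, hbox, hW, hPC1, hPC2, hPC3, hWC, hdich⟩ := hK1
  -- the sup bounds are positive on the window (the datum box sits strictly inside them)
  have hMpos : ∀ k, -Kb ≤ k → k ≤ Ka → 0 < M k := fun k h1 h2 =>
    (abs_nonneg _).trans_lt (hbox 0 (Nat.zero_le _) _ hdat i₀ k h1 h2)
  have hMW : ∀ k, -Kb ≤ k → k ≤ Ka → 0 < M k ∧ 0 ≤ W k := fun k h1 h2 =>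
    ⟨hMpos k h1 h2, hW k h1 h2⟩
  -- the tail lemma K2 for the certificate's data
  obtain ⟨η₂, hη₂, hK2'⟩ :=
    hK2 64 θ c Cb Cg Kb Ka M W α (by norm_num) hα hθ0 hθ.le hc hCb hCg hKb hKa hMW hPC1 hPC2 hPC3 hWC
  -- the margin
  have hηpos : 0 < min η₀ η₂ := lt_min hη₀ hη₂
  have hηle0 : min η₀ η₂ ≤ η₀ := min_le_left _ _
  have hηle2 : min η₀ η₂ ≤ η₂ := min_le_right _ _
  have hηle1 : min η₀ η₂ ≤ 1 := hηle0.trans hη₀1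
  refine ⟨θ, c, min η₀ η₂, i₀, α, X₀,
    (fun S₀ F₀ => (∃ j : ℕ, j ≤ N₀ ∧ ∀ l, |ℓ j l S₀ - ctr j l| ≤ rad j l) ∧
      (∀ i k, k < -Kb → |S₀ i k| ≤ Cb * (2 : ℝ) ^ ((3 : ℝ) / 4 * (-(k : ℝ)))) ∧
      (∀ i k, Ka < k → F₀ i k ≤ Cg * (2 : ℝ) ^ (-(7 : ℝ) * (k : ℝ)))),
    (fun j : ℤ => if j < -Kb then 2 * (Cb * (2 : ℝ) ^ ((3 : ℝ) / 4 * (-(j : ℝ)))) ^ 2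
      else if Ka < j then 5 * (Cg * (2 : ℝ) ^ (-(7 : ℝ) * (j : ℝ))) else (1 / 2) * M j ^ 2 + W j),
    hθ0, hθ.le, hc, hηpos, hα, hX₀, ?_, ?_⟩
  · -- the datum is described by `P`
    refine ⟨⟨0, Nat.zero_le _, hdat⟩, fun i k hk => ?_, fun i k hk => ?_⟩
    · have hk0 : k ≠ 0 := by omega
      rw [datumState_of_ne i₀ X₀ i hk0, abs_zero]
      positivity
    · have hk0 : k ≠ 0 := by omega
      rw [datumEnergy_apply, if_neg hk0, zero_div]
      positivity
  -- the robust step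
  intro L S₀ F₀ B₀ hP hB τ hcτ S F hflow
  obtain ⟨⟨j, hj, hS₀box⟩, hbehind0, hahead0⟩ := hP
  by_contra hno
  have hScont : ∀ i k, ContinuousOn (S i k) (Icc 0 τ) := fun i k =>
    (hflow.contDiffOn_S i k).continuousOn
  have hinit : (fun i k => S i k 0) = S₀ := funext fun i => funext fun k => hflow.init_S i k
  -- KEY: under "no step", weak window bounds on `[0, σ]` are strict and `σ < c`
  have key : ∀ σ, 0 < σ → σ ≤ c →
      (∀ i k, -Kb ≤ k → k ≤ Ka → ∀ u ∈ Icc 0 σ, |S i k u| ≤ M k) →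
      (∀ i k, -Kb ≤ k → k ≤ Ka → ∀ u ∈ Icc 0 σ, |S i k u| < M k) ∧ σ < c := by
    intro σ hσ hσc hwk
    have hστ : σ ≤ τ := hσc.trans hcτ
    obtain ⟨hC1, hC2, hC3, hC4, hC5⟩ := hK2' (min η₀ η₂) σ τ L S₀ F₀ B₀ S F hηpos hηle2 hflow
      hbehind0 hahead0 hB hσ hστ hσc hwk
    have hmotion : ∀ i k, -Kb ≤ k → k ≤ Ka → ∀ s ∈ Icc 0 σ,
        |derivWithin (S i k) (Icc 0 τ) s - quadTerm 1 α S i k s| ≤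
          min η₀ η₂ * (2 : ℝ) ^ ((2 : ℝ) * (k : ℝ)) * Real.sqrt (F i k s) := by
      intro i k _ _ u hu
      have hm := hflow.motion i k u ⟨hu.1, hu.2.trans hστ⟩
      rw [one_add_one_eq_two] at hm
      exact hm
    have hsand : ∀ i k, -Kb ≤ k → k ≤ Ka → ∀ s ∈ Icc 0 σ,
        (1 / 2) * S i k s ^ 2 ≤ F i k s ∧ F i k s ≤ (1 / 2) * S i k s ^ 2 + min η₀ η₂ * W k :=
      fun i k h1 h2 u hu => ⟨hflow.defect_lower i k u ⟨hu.1, hu.2.trans hστ⟩, (hC3 i k h1 h2 u hu).le⟩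
    rcases hdich j (min η₀ η₂) σ τ S F hj hηpos.le hηle0 hσ hστ
        (fun i k _ _ => hflow.contDiffOn_S i k) (by rw [hinit]; exact hS₀box)
        (fun i u hu => (hC1 i u hu).le) (fun i u hu => (hC2 i u hu).le) hmotion hsand with
      hstep | hinside
    · exfalso
      obtain ⟨j', τ₁, a, hj', hτ₁, hτ₁σ, hτ₁c, ha, h2a, haS, hbox', hbot, hwin⟩ := hstep
      have hτ₁I : τ₁ ∈ Icc 0 σ := ⟨hτ₁.le, hτ₁σ⟩
      apply hno
      refine ⟨τ₁, a, ?_⟩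
      dsimp only [StepTo, epochEnvelope]
      refine ⟨hτ₁, hτ₁c, ha, ?_, haS, ⟨⟨j', hj', hbox'⟩, ?_, ?_⟩, ?_⟩
      · rw [one_add_one_eq_two]
        exact h2a
      · -- behind tail of the shifted, rescaled state
        intro i k hk
        rw [abs_div, abs_of_pos ha]
        rcases lt_or_eq_of_le (show (1 : ℤ) + k ≤ -Kb by omega) with hlt | heq
        · have hS := (hC4 i (1 + k) hlt τ₁ hτ₁I).1
          calc |S i (1 + k) τ₁| / a ≤ |S i (1 + k) τ₁| * (2 : ℝ) ^ θ :=
                div_le_mul_two_rpow ha h2a (abs_nonneg _)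
            _ ≤ (2 : ℝ) ^ ((1 : ℝ) / 4) * (Cb * (2 : ℝ) ^ ((3 : ℝ) / 4 * (-(((1 : ℤ) + k : ℤ) : ℝ))))
                  * (2 : ℝ) ^ θ :=
                mul_le_mul_of_nonneg_right hS (Real.rpow_nonneg zero_le_two θ)
            _ ≤ Cb * (2 : ℝ) ^ ((3 : ℝ) / 4 * (-(k : ℝ))) := behind_shift_le hθ.le hCb.le k
        · rw [heq]
          have hcast : (-(k : ℝ)) = (Kb : ℝ) + 1 := by
            have h' : (((1 : ℤ) + k : ℤ) : ℝ) = ((-Kb : ℤ) : ℝ) := by rw [heq]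
            push_cast at h'
            linarith
          rw [hcast]
          exact hbot i
      · -- ahead tail of the shifted, rescaled state
        intro i k hk
        have h1k : Ka < 1 + k := by omega
        have hF := hC5 i (1 + k) h1k τ₁ hτ₁I
        have hFnn : 0 ≤ F i (1 + k) τ₁ := hflow.nonneg_F i (1 + k) τ₁ ⟨hτ₁.le, hτ₁σ.trans hστ⟩
        calc F i (1 + k) τ₁ / a ^ 2 ≤ F i (1 + k) τ₁ * (2 : ℝ) ^ (2 * θ) :=
              div_sq_le_mul_two_rpow ha h2a hFnn
          _ ≤ 5 * (Cg * (2 : ℝ) ^ (-(7 : ℝ) * (((1 : ℤ) + k : ℤ) : ℝ))) * (2 : ℝ) ^ (2 * θ) :=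
              mul_le_mul_of_nonneg_right hF (Real.rpow_nonneg zero_le_two _)
          _ ≤ Cg * (2 : ℝ) ^ (-(7 : ℝ) * (k : ℝ)) := ahead_shift_le hθ.le hCg.le k
      · -- the epoch envelope on `[0, τ₁]`
        intro u hu i k
        have huσ : u ∈ Icc 0 σ := ⟨hu.1, hu.2.trans hτ₁σ⟩
        by_cases hk1 : k < -Kb
        · rw [if_pos hk1]
          exact (hC4 i k hk1 u huσ).2
        · rw [if_neg hk1]
          by_cases hk2 : Ka < k
          · rw [if_pos hk2]
            exact hC5 i k hk2 u huσ
          · rw [if_neg hk2]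
            push Not at hk1 hk2
            have hSM := hwin i k hk1 hk2 u hu
            have hF := hC3 i k hk1 hk2 u huσ
            have h1 : S i k u ^ 2 ≤ M k ^ 2 := by
              rw [← sq_abs (S i k u)]
              exact pow_le_pow_left₀ (abs_nonneg _) hSM 2
            have h2 : min η₀ η₂ * W k ≤ W k := mul_le_of_le_one_left (hW k hk1 hk2) hηle1
            linarith
    · exact ⟨hinside.2, hinside.1⟩
  -- the set of times up to which the window bounds hold
  set s : Set ℝ := {σ | σ ∈ Icc (0 : ℝ) c ∧ ∀ i k, -Kb ≤ k → k ≤ Ka → |S i k σ| ≤ M k} with hs_def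
  have hs_sub : s ⊆ Icc 0 c := fun σ hσ => hσ.1
  have hs_closed : IsClosed (s ∩ Icc 0 c) := by
    rw [inter_eq_left.mpr hs_sub]
    have hs_eq : s = ⋂ i : Fin 4, ⋂ k : ℤ,
        {σ | σ ∈ Icc (0 : ℝ) c ∧ (-Kb ≤ k → k ≤ Ka → |S i k σ| ≤ M k)} := by
      ext σ
      simp only [hs_def, mem_setOf_eq, mem_iInter]
      constructor
      · rintro ⟨h1, h2⟩ i k
        exact ⟨h1, h2 i k⟩
      · intro h
        exact ⟨(h 0 0).1, fun i k => (h i k).2⟩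
    rw [hs_eq]
    refine isClosed_iInter fun i => isClosed_iInter fun k => ?_
    by_cases hk : -Kb ≤ k ∧ k ≤ Ka
    · have hset : {σ | σ ∈ Icc (0 : ℝ) c ∧ (-Kb ≤ k → k ≤ Ka → |S i k σ| ≤ M k)} =
          {σ ∈ Icc (0 : ℝ) c | |S i k σ| ≤ M k} := by
        ext σ
        simp only [mem_setOf_eq]
        exact ⟨fun h => ⟨h.1, h.2 hk.1 hk.2⟩, fun h => ⟨h.1, fun _ _ => h.2⟩⟩
      rw [hset]
      exact isClosed_Icc.isClosed_le ((hScont i k).mono (Icc_subset_Icc_right hcτ)).abs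
        continuousOn_const
    · have hset : {σ | σ ∈ Icc (0 : ℝ) c ∧ (-Kb ≤ k → k ≤ Ka → |S i k σ| ≤ M k)} = Icc 0 c := by
        ext σ
        simp only [mem_setOf_eq]
        exact ⟨fun h => h.1, fun h => ⟨h, fun h1 h2 => absurd ⟨h1, h2⟩ hk⟩⟩
      rw [hset]
      exact isClosed_Icc
  have h0s : (0 : ℝ) ∈ s := by
    refine ⟨⟨le_rfl, hc.le⟩, fun i k h1 h2 => ?_⟩
    rw [hflow.init_S]
    exact (hbox j hj S₀ hS₀box i k h1 h2).le
  have hIcc : Icc 0 c ⊆ s := by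
    refine hs_closed.Icc_subset_of_forall_mem_nhdsGT_of_Icc_subset h0s fun t ht hts => ?_
    -- strict window bounds at time `t`
    have hstrict : ∀ i k, -Kb ≤ k → k ≤ Ka → |S i k t| < M k := by
      rcases ht.1.eq_or_lt with h0 | htpos
      · rw [← h0]
        intro i k h1 h2
        rw [hflow.init_S]
        exact hbox j hj S₀ hS₀box i k h1 h2
      · have hweak : ∀ i k, -Kb ≤ k → k ≤ Ka → ∀ u ∈ Icc 0 t, |S i k u| ≤ M k :=
          fun i k h1 h2 u hu => (hts hu).2 i k h1 h2
        exact fun i k h1 h2 => (key t htpos ht.2.le hweak).1 i k h1 h2 t ⟨ht.1, le_rfl⟩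
    -- by continuity they persist on a right neighbourhood of `t`
    have htτ : t < τ := ht.2.trans_le hcτ
    have hle : 𝓝[>] t ≤ 𝓝[Icc 0 τ] t := by
      rw [← nhdsWithin_Ioo_eq_nhdsGT htτ]
      exact nhdsWithin_mono _ fun x hx => ⟨ht.1.trans hx.1.le, hx.2.le⟩
    have hev : ∀ᶠ σ in 𝓝[>] t, ∀ i : Fin 4, ∀ k ∈ Finset.Icc (-Kb) Ka, |S i k σ| < M k := by
      refine eventually_all.mpr fun i => (eventually_all_finset _).mpr fun k hk => ?_
      rw [Finset.mem_Icc] at hk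
      have hcont : ContinuousWithinAt (S i k) (Icc 0 τ) t :=
        (hScont i k).continuousWithinAt ⟨ht.1, htτ.le⟩
      exact ((hcont.tendsto.abs).eventually (gt_mem_nhds (hstrict i k hk.1 hk.2))).filter_mono hle
    filter_upwards [hev, Icc_mem_nhdsGT ht.2] with σ hσ hσ'
    exact ⟨⟨ht.1.trans hσ'.1, hσ'.2⟩, fun i k h1 h2 => (hσ i k (Finset.mem_Icc.mpr ⟨h1, h2⟩)).le⟩
  have hweak : ∀ i k, -Kb ≤ k → k ≤ Ka → ∀ u ∈ Icc 0 c, |S i k u| ≤ M k :=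
    fun i k h1 h2 u hu => (hIcc hu).2 i k h1 h2
  exact lt_irrefl c (key c hc le_rfl hweak).2


/-- **Glue 2 (proved): robust-step data at spread 64 ⇒ the rung leaf `TargetR64`**
(the route `TaoLadderRungThree`'s own restart/renormalisation items stmt-20424/20425/20426, all proved,
applied pointwise at `R = 64` — the `closes` argument of `ExactWindowRungThree` with the spread pinned). -/
theorem targetR64_of_robustStepDataAt64 (h : RobustStepDataAt 64) :
    Summit.NavierStokesRegularity.NavierStokesRegularity.Theses.TaoLadderRungThree.TargetR64 := by
  obtain ⟨θ, c, η, i₀, α, X₀, P, env, hθ0, hθ, hc, hη, hα, hX₀, hP, hstep⟩ := h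
  have h₅ := taoLadderRungThree_restartControl_proof
  have h₆ := taoLadderRungThree_restartGlue_proof
  have h₇ := taoLadderRungThree_localDynamicsSufficesAt_proof
  unfold Summit.NavierStokesRegularity.NavierStokesRegularity.Theses.TaoLadderRungThree.RestartControl at h₅
  unfold Summit.NavierStokesRegularity.NavierStokesRegularity.Theses.TaoLadderRungThree.RestartGlue at h₆
  unfold Summit.NavierStokesRegularity.NavierStokesRegularity.Theses.TaoLadderRungThree.LocalDynamicsSufficesAt at h₇
  have hε₀ : (0 : ℝ) < 1 := one_pos
  have hdyn : Literature.Analysis.FluidPDE.TaoCascade.DynamicsLocalAt 1 64 := by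
    refine ⟨θ, c, i₀, α, X₀, P, Literature.Analysis.FluidPDE.TaoCascade.epochEnvelope env,
      hθ0, by linarith, hc, hα, hX₀, hP, ?_⟩
    intro K₁ K₂ hK₁ hK₂
    obtain ⟨N₀, hN₀⟩ := h₅ 1 θ c η i₀ α X₀ P env K₁ K₂ hε₀ hθ hc.le hη hX₀ hK₁ hK₂
    refine ⟨N₀, fun n₀ hn₀ T hT X E hsol N hN t e hcp hhor => ?_⟩
    have heN : 0 < e N := hcp.e_pos N hN le_rfl
    have hpow : 0 < (1 + (1 : ℝ)) ^ ((5 : ℝ) * N / 2) := Real.rpow_pos_of_pos (by norm_num) _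
    have hγ : 0 < e N * (1 + (1 : ℝ)) ^ ((5 : ℝ) * N / 2) := mul_pos heN hpow
    have hneg : (1 + (1 : ℝ)) ^ (-(5 : ℝ) * N / 2) = ((1 + (1 : ℝ)) ^ ((5 : ℝ) * N / 2))⁻¹ := by
      rw [← Real.rpow_neg (by norm_num : (0 : ℝ) ≤ 1 + 1)]
      congr 1
      ring
    have hcγ : c * (1 + (1 : ℝ)) ^ (-(5 : ℝ) * N / 2) * (e N)⁻¹ =
        c / (e N * (1 + (1 : ℝ)) ^ ((5 : ℝ) * N / 2)) := by
      rw [hneg]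
      field_simp
    rw [hcγ] at hhor
    have hdiv : 0 < c / (e N * (1 + (1 : ℝ)) ^ ((5 : ℝ) * N / 2)) := div_pos hc hγ
    have htN : t N < T := by linarith
    have hτ : c ≤ (T - t N) * (e N * (1 + (1 : ℝ)) ^ ((5 : ℝ) * N / 2)) := by
      have h2 : c / (e N * (1 + (1 : ℝ)) ^ ((5 : ℝ) * N / 2)) ≤ T - t N := by linarith
      have h3 := mul_le_mul_of_nonneg_right h2 hγ.le
      rwa [div_mul_cancel₀ c hγ.ne'] at h3
    obtain ⟨hflow, hslack⟩ := hN₀ n₀ hn₀ T hT X E hsol N hN t e hcp htN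
    obtain ⟨τ₁, a, hst⟩ :=
      hstep (N - n₀).toNat _ _ _ (hcp.state N hN le_rfl) hslack _ hτ _ _ hflow
    exact ⟨_, _, h₆ 1 θ c 4 i₀ n₀ X₀ _ _ N X E t e τ₁ a hε₀ hN hcp hst⟩
  obtain ⟨α', X₀', hα', hng⟩ := h₇ 1 64 one_pos (by norm_num) hdyn
  exact ⟨α', X₀', hα', hng⟩

/-! ### The certificate object of this line (stub K_M) and the soundness stub (S_M) -/


/-- **Corollary (the by-product of the line, stub-free).** A pinned (`R = 64` by name) K1-type inclusion
trapping certificate closes the rung of record TL-M3-R64. -/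
theorem targetR64_of_windowCertificateAt64 (hK1 : WindowCertificateAt 64) :
    Summit.NavierStokesRegularity.NavierStokesRegularity.Theses.TaoLadderRungThree.TargetR64 :=
  targetR64_of_robustStepDataAt64
    (robustStepDataAt64_of_windowCertificateAt64 hK1 trappingWindowRungThree_tailEnvelopes_proof)

end Summit.NavierStokesRegularity.NavierStokesRegularity.Theorems

end
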